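import Summits.HodgeConjecture.HodgeConjecture.Theorems.Ring2AbelianAllAndrePrimitiveLiftLefschetzDegree
import Summits.HodgeConjecture.HodgeConjecture.Theorems.Ring2AbelianAllAndrePrimitiveLiftRows
import Summits.HodgeConjecture.HodgeConjecture.Theorems.Ring2AbelianAllStandardAPencils
import HarnessLib

/-!
# Ring 2 · sub-cell AbelianAll (ALL ABELIAN VARIETIES), André axis, part XXIII-d — NODE LEVEL: the CM bracket of the graded
# Lefschetz clauses `A_r(𝒳, K)` (`4 ≤ 2r ≤ d`), its place between ab-andre-1's `A`-node and the lift (L), the `HC_AV` row;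
# the W₆ rows at the `E`-power points from rank-one `H⁴`-invariants and the single clause `A₃(𝒳⁷, K)`

HONEST FRAMING (page 1, verbatim): **research route, not a corollary; conditional on HC_CM plus one named
minimal statement.** Cell line: research route conditional on HC_CM; not a corollary; Q11.4-sentence-2
already refuted in dim ≥ 3. Nothing in this file proves a case of the Hodge conjecture for an abelian variety; `HC_CM` =
`Theses.RankFourFaces.CMAbelianHodge` (stmt-3052) is a BINDER of the single row `HC_AV_of_HC_CM_of_cmLefschetzDegrees` and occurs
nowhere else; `HC_AV` = `Theses.PadicSemiregularLift.HodgeAbelianVarieties` (stmt-1333); item `Theses.RankFourFaces.CMToAbelian`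
(stmt-16267) OPEN and not closed here. Seat `pub-hodge-ring2-ab-andre-2`, gen 15; brief (ii) "replace B by algebraicity of specific
Lefschetz components — record each version; prove the implications between the candidates".

## What is proved (theorems only; no definition — the brackets are display-only local notations —, no named fact, no sorry)

* `exists_eq_lefschetzPowTo_of_standardConjectureA` (one bidegree of `A(X, η)` in the `lefschetzPowTo` spelling),
  `two_mul_add_two_mul_add_one` (degree bookkeeping).
* Bracket `CMLefschetzDegrees[]` := for every CM-pointed compact pencil of abelian `d`-folds, every Kähler–rational datum `D` of the
  total space whose class polarises the fibres, every `2 ≤ r`, `2r + m = d`: `L_{D.Hη}^{m+1} : Nʳ(𝒳) → N^{r+m+1}(𝒳)` onto.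
* **`cmLefschetzDegrees_of_cmPointedPencilStandardA`**: ab-andre-1's node `CMPointedPencilStandardA` (`A(𝒳, η)` for every
  polarisation class) ⟹ the bracket (K). `cmLefschetzDegrees_of_hodgeConjecture` (ON-PATH under the full Hodge conjecture, K).
* **`cmFibreAlgebraicLift_of_cmLefschetzDegrees`**: the bracket ⟹ (L) `CMFibreAlgebraicLift` (K; part XXIII-c at the CM points).
* **`HC_AV_of_HC_CM_of_cmLefschetzDegrees (h₂₁) (hCM) (h)`**: `h₂₁ → HC_CM → CMLefschetzDegrees[] → HC_AV` — K[h₂₁].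
* **`primitiveLiftE_six_of_rankOne_of_lefschetzDegree_three`**, **`weilSixfolds_of_cmPowerWeilPencilsAt_of_rankOne_of_lefschetzDegree_three`**:
  `(W_E)₃ ∧ [at the E-power points of the compact pencils of abelian sixfolds: rank-one H⁴-invariants and L_K : N³(𝒳) → N⁴(𝒳)
  onto for the Kähler–rational data K] ⟹ WeilSixfolds` — K, `HC_CM` IDLE.

IMPLICATION GRAPH (RING2-MAP §AbelianAll gen 15; labels as AA2.98/AA2.111): (A^CM) ⟹ CMLefDeg K; CMLefDeg ⟹ (L) K;
`HC_CM ∧ CMLefDeg ⟹ HC_AV` K[h₂₁]; HodgeConjecture ⟹ CMLefDeg K. HONEST ACCOUNTING: at node level the bracket is ab-andre-1's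
`A`-node restricted to the hyperplane classes and to the bidegrees `(r, d+1-r)`, `4 ≤ 2r ≤ d` — which by ab-andre-1's
`standardConjectureA_of_surjOn_two_le` is all of `A(𝒳, K)`: NO new node, nothing minimal, nothing fact-free on `HC_AV`, and the
bracket is not known to follow from `HC_AV` (only from the full Hodge conjecture). What is new is POINTWISE and GRADED (part
XXIII-c): the primitive lift in ONE degree `2r` costs ONE clause `A_r(𝒳, K)` (given the lift below), so that wherever the lower
primitive invariants are absent — the W₆ habitat with rank-one `H⁴`-invariants — the single clause `A₃(𝒳⁷, K)` carries the Weil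
classes: `B_min` for that row is "every codimension-4 algebraic class of the sevenfold total space is homologically `K ∪` a
codimension-3 algebraic class".

References: Grothendieck1968 (§3 p. 196); Kleiman1968AlgebraicCycles (§3); Lieberman1968 (Thm. 1); Milne2020HodgeClassesAV (Prop. 1
p. 7); Andre1996Motifs (Lemme 6.3.1, 6.3.3, §6.3 Remarque 2); vanGeemen1994HodgeAV (Thm. 4.3, 5.12, 6.12); Abdulali1994FamiliesAV (p. 1122).
-/

noncomputable section

set_option linter.dupNamespace false

namespace Summit.HodgeConjecture.HodgeConjecture.Ring2.AbelianAll

open CategoryTheory AlgebraicGeometry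
open Literature.AlgebraicGeometry Literature.AlgebraicGeometry.Motives
open Literature.AlgebraicGeometry.HodgeTheory
open Literature.AlgebraicTopology.SingularHomology (singularCohomology cupProduct cupProduct_map)
open Literature.Geometry.Kaehler (lefschetzOperator lefschetzPow HasHardLefschetzProperty)

variable {𝒳 S : SchemeOver ℂ}

/-! ## §8 Node level: the CM bracket `CMLefschetzDegrees[]`, the `HC_AV` row, its place between ab-andre-1's `A`-node and
(L); the W₆ rows at `E`-power points -/

section Nodes

open Literature.AlgebraicGeometry.Deligne1982 (cmLocus)
open Literature.AlgebraicGeometry.Andre1996 (andre1996_cmAnchoredPencil)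
open Summit.HodgeConjecture.HodgeConjecture.Theses
open Summit.HodgeConjecture.HodgeConjecture.Ring2.Hypotheses (cmPowerLocus)

/-- `A(X, η)` in ONE bidegree, in the `lefschetzPowTo` spelling with a free target degree (transport of the tree's
`StandardConjectureA.exists_eq_lefschetzPow`). [cite: Grothendieck1968, §3 p. 196 (A(X))] -/
theorem exists_eq_lefschetzPowTo_of_standardConjectureA {n : ℕ} {X : SchemeOver ℂ} {η : complexBetti X 2}
    (hA : StandardConjectureA n X η) {p r q : ℕ} (hpr : 2 * p + r = n) (hq : p + r = q) {m' : ℕ}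
    (hm' : 2 * p + 2 * r = m') {y : complexBetti X m'} (hy : y ∈ supportedClasses X m' q) :
    ∃ x ∈ algebraicClasses X p, lefschetzPowTo η r (2 * p) m' hm' x = y := by
  subst hm'
  exact hA.exists_eq_lefschetzPow hpr hq hy

/-- Degree bookkeeping for the bracket below: `2r + 2(m+1) = 2(r+m+1)`. [folklore] -/
theorem two_mul_add_two_mul_add_one (r m : ℕ) : 2 * r + 2 * (m + 1) = 2 * (r + m + 1) := by
  omega

/-- Display-only shape (no `def`): **THE CM BRACKET OF THE GRADED LEFSCHETZ CLAUSES** — for every CM-pointed compact pencil of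
abelian `d`-folds, every Kähler–rational datum `D` of the total space whose class polarises the fibres, and every `r`, `m` with
`2 ≤ r`, `2r + m = d`: `L_{D.Hη}^{m+1} : Nʳ(𝒳) → N^{r+m+1}(𝒳)` is onto (the clause of `A(𝒳, D.Hη)` in codimension `r`). -/
local notation3 (prettyPrint := false) "CMLefschetzDegrees[]" =>
  ∀ ⦃d : ℕ⦄ ⦃𝒳 S : SchemeOver ℂ⦄ (f : 𝒳 ⟶ S) (_ : IsCompactAbelianPencil f d) (t : ComplexPoints S),
    t ∈ cmLocus f d → ∀ (D : KaehlerRationalDatum (d + 1) 𝒳),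
    (∀ s : ComplexPoints S, IsPolarizationClass d (fiberOver f s) (complexBetti.map (fiberι f s) 2 D.Hη)) →
    ∀ (r m : ℕ), 2 ≤ r → (hrm : 2 * r + m = d) → ∀ y ∈ algebraicClasses 𝒳 (r + m + 1),
      ∃ x ∈ algebraicClasses 𝒳 r,
        lefschetzPowTo D.Hη (m + 1) (2 * r) (2 * (r + m + 1)) (two_mul_add_two_mul_add_one r m) x = y

/-- **ab-andre-1's node `CMPointedPencilStandardA` (`A(𝒳, η)` for EVERY polarisation class of every CM-pointed compact abelian
pencil) implies the bracket** (each clause is one bidegree of `A(𝒳, D.Hη)`). [cite: Grothendieck1968, §3 p. 196 (A(X))]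
[cite: Milne2020HodgeClassesAV, Prop. 1 (p. 7)] -/
theorem cmLefschetzDegrees_of_cmPointedPencilStandardA (hA : CMPointedPencilStandardA) : CMLefschetzDegrees[] := by
  intro d 𝒳 S f hf t ht D _ r m _ hrm y hy
  have hAt : StandardConjectureA (d + 1) 𝒳 D.Hη :=
    cmPointedPencilStandardA_iff_forall.1 hA d f hf ⟨t, ht⟩ D.Hη (isPolarizationClass_Hη hf.isSmoothProjective_total D)
  exact exists_eq_lefschetzPowTo_of_standardConjectureA hAt (by omega) rfl _ hy

/-- **ON-PATH: `HodgeConjecture ⟹ CMLefschetzDegrees[]`** (the Hodge conjecture of the total space gives `A(𝒳, η)`, ab-andre-1's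
`compactAbelianPencilStandardA_of_hodgeConjecture`). [cite: Grothendieck1968, §3 p. 196] -/
theorem cmLefschetzDegrees_of_hodgeConjecture (h : _root_.HodgeConjecture) : CMLefschetzDegrees[] :=
  cmLefschetzDegrees_of_cmPointedPencilStandardA
    (cmPointedPencilStandardA_of_compactAbelianPencilStandardA (compactAbelianPencilStandardA_of_hodgeConjecture h))

/-- **THE BRACKET IMPLIES (L) `CMFibreAlgebraicLift`** — the André-axis lift at the CM points, with NO `HC_CM`, no named fact:
the whole lift at `t` from the graded clauses (part XXIII-c `comap_le_sup_of_forall_lefschetzDegree`), read through part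
XVII-b's lattice form of (L). [cite: Andre1996Motifs, §5.1 (p. 25) and §6.3 (p. 33)] [cite: Grothendieck1968, §3 p. 196 (A(X))] -/
theorem cmFibreAlgebraicLift_of_cmLefschetzDegrees (h : CMLefschetzDegrees[]) : CMFibreAlgebraicLift := by
  refine cmFibreAlgebraicLift_iff_comap_le_sup.2 fun d 𝒳 S f hf p t ht ↦ ?_
  rcases Nat.eq_zero_or_pos d with rfl | hd
  · obtain ⟨K, hKalg, -, hKs⟩ := exists_algebraic_globalPolarization hf
    exact comap_le_sup_of_primitiveLift hf t hKalg (fun s ↦ (hKs s).hasHardLefschetz) (hKs t) p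
      (fun p' r' q' _ _ h1 h2 ↦ ((standardConjectureA_fiberOver hf t (hKs t)).2 p' r' q' h1 h2).surjOn)
      (fun r h2r _ hrd ↦ absurd hrd (by omega))
  · obtain ⟨D, hD⟩ := exists_kaehlerRationalDatum_polarization_fibres hf hd
    exact comap_le_sup_of_forall_lefschetzDegree hf t D (fun s ↦ (hD s).hasHardLefschetz) (hD t)
      (fun r m h2r hrm y hy ↦ h f hf t ht D hD r m h2r hrm y hy) p

/-- **THE CELL ROW `h₂₁ → HC_CM → CMLefschetzDegrees[] → HC_AV`** — `B_min` in the Lefschetz column replaced by ONE clause of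
Grothendieck's `A(𝒳, K)` per primitive degree `4 ≤ 2r ≤ d` (`K` the rational hyperplane class of the total space of each
CM-pointed compact abelian pencil), modulo André's Lemme 6.3.1 (`h₂₁`) only. research route, not a corollary; conditional on
HC_CM plus one named minimal statement; nothing minimal is claimed. [cite: Andre1996Motifs, Lemme 6.3.1 (p. 31) and Remarque 2 (p. 33)]
[cite: Grothendieck1968, §3 p. 196 (A(X))] [cite: Milne2020HodgeClassesAV, Prop. 1 (p. 7)] -/
theorem HC_AV_of_HC_CM_of_cmLefschetzDegrees (h₂₁ : andre1996_cmAnchoredPencil) (hCM : RankFourFaces.CMAbelianHodge)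
    (h : CMLefschetzDegrees[]) : PadicSemiregularLift.HodgeAbelianVarieties :=
  HC_AV_of_HC_CM_and_cmFibreAlgebraicLift h₂₁ hCM (cmFibreAlgebraicLift_of_cmLefschetzDegrees h)

/-- Display-only shape (no `def`), VERBATIM as in parts XXI-b/XXII-d: `PrimE[d]`, the primitive lifts at the `E`-power points. -/
local notation3 (prettyPrint := false) "PrimE[" d "]" =>
  ∀ ⦃𝒳 S : SchemeOver ℂ⦄ (f : 𝒳 ⟶ S) (_ : IsCompactAbelianPencil f d) (t : ComplexPoints S),
    t ∈ cmPowerLocus f d → ∀ (K : complexBetti 𝒳 2), K ∈ algebraicClasses 𝒳 1 →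
    (∀ s : ComplexPoints S, IsPolarizationClass d (fiberOver f s) (complexBetti.map (fiberι f s) 2 K)) →
    ∀ r, 2 ≤ r → 2 * r ≤ d → ∀ ξ ∈ algebraicClasses (fiberOver f t) r,
      ξ ∈ primitiveClasses (complexBetti.map (fiberι f t) 2 K) d (2 * r) →
      ξ ∈ LinearMap.range (complexBetti.map (fiberι f t) (2 * r)).hom →
      ξ ∈ (algebraicClasses 𝒳 r).map (complexBetti.map (fiberι f t) (2 * r)).hom

/-- **`PrimE[6]` FROM RANK-ONE `H⁴`-INVARIANTS AND THE SINGLE CLAUSE `A₃(𝒳⁷, K)` AT THE `E`-POWER POINTS** of the compact pencils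
of abelian sixfolds (`K` the rational hyperplane class of any Kähler–rational datum of the sevenfold polarising the fibres): the
whole lift at `t` (part XXIII-c) is independent of the polarising class, so it gives (Prim)_t for every `K` (part XXII-d).
[cite: Grothendieck1968, §3 p. 196 (A(X))] [cite: vanGeemen1994HodgeAV, Thm. 4.3 and 6.12] -/
theorem primitiveLiftE_six_of_rankOne_of_lefschetzDegree_three
    (h : ∀ ⦃𝒳 S : SchemeOver ℂ⦄ (f : 𝒳 ⟶ S) (hf : IsCompactAbelianPencil f 6) (t : ComplexPoints S), t ∈ cmPowerLocus f 6 →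
      Module.finrank ℂ (LinearMap.range (complexBetti.map (fiberι f t) (2 * 2)).hom) = 1 ∧
      ∀ D : KaehlerRationalDatum (6 + 1) 𝒳,
        (∀ s : ComplexPoints S, IsPolarizationClass 6 (fiberOver f s) (complexBetti.map (fiberι f s) 2 D.Hη)) →
        ∀ y ∈ algebraicClasses 𝒳 4, ∃ x ∈ algebraicClasses 𝒳 3, lefschetzPowTo D.Hη 1 (2 * 3) (2 * 4) (by omega) x = y) :
    PrimE[6] := by
  intro 𝒳 S f hf t ht K hKalg hKs r h2r hrd ξ hξ hP hI
  obtain ⟨h1, hA⟩ := h f hf t ht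
  obtain ⟨D, hD⟩ := exists_kaehlerRationalDatum_polarization_fibres hf (by omega)
  have hlift := forall_comap_le_sup_of_rankOne_of_lefschetzDegree_three hf t D (fun s ↦ (hD s).hasHardLefschetz) (hD t) h1
    (hA D hD)
  exact (forall_comap_le_sup_iff_primitiveLift hf t hKalg hKs).1 hlift r h2r hrd ξ hξ hP hI

/-- **`(W_E)₃ ∧ [rank-one `H⁴`-invariants and `L_K : N³(𝒳) → N⁴(𝒳)` onto, at the `E`-power points of the compact pencils of
abelian sixfolds] ⟹ WeilSixfolds`** — the Weil-sixfold item of route `SevenfoldWeilCensus` from ONE surjectivity clause on the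
codimension-`3`/`4` algebraic classes of the sevenfold total spaces (through parts XXI-b §7 / XIX-f). `HC_CM` IDLE; no named
fact; `(W_E)₃` (`CMPowerAnchoredCompactWeilPencilsAt 3`, part IX) is an OPEN habitat node. research route, not a corollary;
conditional on HC_CM plus one named minimal statement. [cite: Grothendieck1968, §3 p. 196 (A(X))]
[cite: Andre1996Motifs, Lemme 6.3.3 (p. 33)] [cite: vanGeemen1994HodgeAV, Thm. 4.3, 5.12 and 6.12] -/
theorem weilSixfolds_of_cmPowerWeilPencilsAt_of_rankOne_of_lefschetzDegree_three (hW : CMPowerAnchoredCompactWeilPencilsAt 3)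
    (h : ∀ ⦃𝒳 S : SchemeOver ℂ⦄ (f : 𝒳 ⟶ S) (hf : IsCompactAbelianPencil f 6) (t : ComplexPoints S), t ∈ cmPowerLocus f 6 →
      Module.finrank ℂ (LinearMap.range (complexBetti.map (fiberι f t) (2 * 2)).hom) = 1 ∧
      ∀ D : KaehlerRationalDatum (6 + 1) 𝒳,
        (∀ s : ComplexPoints S, IsPolarizationClass 6 (fiberOver f s) (complexBetti.map (fiberι f s) 2 D.Hη)) →
        ∀ y ∈ algebraicClasses 𝒳 4, ∃ x ∈ algebraicClasses 𝒳 3, lefschetzPowTo D.Hη 1 (2 * 3) (2 * 4) (by omega) x = y) :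
    Theses.SevenfoldWeilCensus.WeilSixfolds :=
  weilSixfolds_of_cmPowerWeilPencilsAt_of_primitiveLiftE hW (primitiveLiftE_six_of_rankOne_of_lefschetzDegree_three h)

end Nodes

end Summit.HodgeConjecture.HodgeConjecture.Ring2.AbelianAll

end
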